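import Summits.Schanuel.Schanuel.Theorems.RootDecomp1KHyper19
import Summits.Schanuel.Schanuel.Theorems.RootDecomp1KGeneric21

/-!
# RootDecomp1KRelLiouvilleCell — lens 1, generation 34 «RELATIVE-LIOUVILLE CELL of 33364» (RootDecomp1KRelLiouvilleCell.lean fc1db392…, 1985 l) — part 1 (RootDecomp1KRelLiouvilleCell01): §1 the classes `LogPowMeasure θ` / `LogHyperLiouville ρ` at log-power scale; §2 several-variables bookkeeping (`ycoeff`, size bound, splitting off the first variable)

PORT NOTE (census-1 gen 15, 2026-08-31): port of HOME/decomp-schanuel-lens-1/g34/RootDecomp1KRelLiouvilleCell.lean (sha256 fc1db392…9176, 1985 l; own farm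
rc 0 · 0 warn · 0 sorry · axioms std; critic VERDICT STATUS L1658: checklist L1619 (1)–(4) MET, ONE cell-decision credit (K-R16) to lens-1 g34; PORT GO LOW
census lane; writer re-check L1660) in EIGHT parts `RootDecomp1KRelLiouvilleCell01`–`08` (the verdict's three-part scheme §1–§3 / §4–§5 / §6–§8 exceeds the
400-line cap: 01 = §1–§2 classes `LogPowMeasure` / `LogHyperLiouville` + bookkeeping, 02 = §3 extraction, 03 = §4 first half (ℓ₂ partial sums, window
lemmas), 04 = §4 THE INDUCED MEASURE `induced_logPow_measure_cons_liouvilleNumber` / `logPowMeasure_cons_liouvilleNumber`, 05 = §5 `Fin 1` transfer + §6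
the member coordinate `ℓ_T`, 06 = §7 shared-digit machinery up to `exists_digit_ne_zero`, 07 = §7 `tower_budget` / `form_lower_bound`, 08 = §8 the cells
against item 33364 and the members `z_R`, `z_R^π`). The three `set_option linter.*` lines dropped; the unused private helper `exp_neg_le_one_div'` deleted;
34 one-line docstrings added; `factorial_add_le_mul_pow`, `summable_one_div_two_pow_factorial` made `private`; ONE lint fix: the unused binder `hA₀` of `two_mul_prod_le_exp` renamed `_hA₀` (statement shape unchanged); everything else verbatim;
`hNW : NWMeasure` stays a binder BY NAME (tree-proved text, farm-unbuilt cone); no Theses import (the LIVE-item probes stay in HOME RLprobe.lean).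
`--supports stmt-Schanuel-33364`; no census credit. Nothing here proves Schanuel; rung 0. The lens's header follows.
-/

/-!
# RootDecomp1K — lens 1 (grading / quantitative ladder), gen 34: the «RELATIVE-LIOUVILLE CELL» of item 33364
# (`FiniteOrderLiouvilleSchanuel`, A₄ᵈ) — Schanuel's bound on `{(1, ℓ₂, ρ) : ρ log-hyper-Liouville}` (and its
# π-twin `{(π, πℓ₂, πρ)}`, HYPOTHESIS-FREE), WITH THE EXPLICIT CERTIFIED MEMBER `z_R = (1, ℓ₂, ℓ_T)`

Cell decomp-schanuel, seat `decomp-schanuel-lens-1`, gen 34 (2026-08-31); the ONE cell-decision credit reserved to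
lens 1 by RULE K-R16 (STATUS L1611/L1619: «a decided cell of 33364 whose members are NOT moment curves / whose
mechanism is not exponential order»).  Route of record `route-Schanuel-RootDecomp1K` (DRAFT; `closes hL hH hF hB`),
item **F** = `Summit.Schanuel.Schanuel.Theses.RootDecomp1K.FiniteOrderLiouvilleSchanuel` (stmt-Schanuel-33364):
Schanuel's bound for the `ℚ`-free tuples with small integer linear forms to EVERY POLYNOMIAL order but NOT to
every exponential order.  Nothing here proves Schanuel; rung 0.  No 1K decl is restated: the item is consumed
BY NAME in the probe file (`RLprobe.lean`: `critProbe_F1/F1pi` `intro …; exact h33364 …`, `critProbe_F2/F2pi`).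

## Why this cell is new (K-R16)
Every decided cell of 33364 so far (lens 6 g13/g14, lens 1 g32/g33) is a MOMENT CURVE `(ℓ, ℓ², …)` of ONE real
and its mechanism is the EXPONENTIAL ORDER of `ℓ` (or log-square at level 2).  Here the tuple has THREE unrelated
coordinates `1, ℓ₂ = Σ 2^{-k!}` (Liouville's constant: every polynomial order, NO exponential order, not even
log-square — `not_logSqLiouville_liouvilleNumber`), and `ρ`; the small forms come from the PREFIX `(1, ℓ₂)`
(polynomial orders only), the transcendence input is a measure of `ρ` RELATIVE to `(ℓ₂, e)` — whence the name.
Mechanism = an INDUCED MEASURE (§4, new object): ℓ₂'s own Diophantine scales `2^{N!}` convert a polynomial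
measure of `θ` into a LOG-POWER measure of `(ℓ₂, θ)`, which a LOG-HYPER-Liouville `ρ` then beats (§3).

## Content (sorry-free; axioms `propext, Classical.choice, Quot.sound`; imports tree Theorems only)
* §1 two classes at log-power scale: `LogPowMeasure θ` (`|P(θ)| ≥ exp(−C_d(1+log len P)^{k_d})`; between the
  tree's `MvPolyMeasure` and `MvWeakMeasure`) and `LogHyperLiouville ρ` (`|ρ − p/q| < exp(−(log q)^m)` for every
  `m`; between `LogSqLiouville` and exponential order 1), with the ladder lemmas.
* §2 several-variables bookkeeping (`ycoeff`, slicing off `X₀`, length/degree of slices).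
* §3 EXTRACTION `LogPowMeasure θ ∧ LogHyperLiouville ρ ⇒ (ρ, θ)` algebraically independent
  (`algebraicIndependent_option_of_logPowMeasure_logHyperLiouville`) ⇒ `sb_of_logHyperLiouville_of_logPowMeasure`.
* §4 THE INDUCED MEASURE `induced_logPow_measure_cons_liouvilleNumber (hθ : MvPolyMeasure θ) (d) : ∃ C > 0, ∀ Q ≠ 0,
  totalDegree Q ≤ d → exp(−(C(1 + log len Q))^{d+2}) ≤ ‖Q(ℓ₂, θ)‖` — explicit exponent `d + 2`, NO named fact;
  class form `logPowMeasure_cons_liouvilleNumber : MvPolyMeasure θ → LogPowMeasure (ℓ₂, θ)`.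
* §5 `Fin 1`: `PolyMeasure t ⇒ MvPolyMeasure ![t]`; instances `logPowMeasure_liouvilleNumber_pi` (UNCONDITIONAL,
  tree `polyMeasure_pi`) and `logPowMeasure_liouvilleNumber_exp_one (hNW : NWMeasure)`.
* §6 THE MEMBER COORDINATE `ℓ_T := Σ_j 2^{−(t_j)!}`, `t₀ = 2`, `t_{j+1} = 2^{t_j}` (a lacunary SUB-series of ℓ₂'s
  digit skeleton) and `logHyperLiouville_ellT : LogHyperLiouville ℓ_T` (hypothesis-free).
* §7 THE SHARED-DIGIT CERTIFICATE `form_lower_bound (h ≠ 0) : exp(−(1+Σ|hᵢ|)^11) ≤ |h₀ + h₁ℓ₂ + h₂ℓ_T|`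
  (hypothesis-free): the digits `u_k = h₁ + h₂·1_T(k)` of the form are bounded by `S` and one of them is
  NON-ZERO at a position `P ≤ 2^{n₀} + 2` just past the first admissible scale; digit lemma `digit_lower_bound`.
* §8 THE CELL THEOREMS with 33364's binders VERBATIM + ONE cell line after `LinearIndependent ℚ z`:
  `finiteOrderLiouvilleSchanuel_relLiouvilleCell (hNW) (hρ : LogHyperLiouville ρ)` — cell
  `Set.range z = Set.range ![1, ℓ₂, ρ]`; `finiteOrderLiouvilleSchanuel_relLiouvilleCell_pi (hρ)` — cell
  `Set.range z = Set.range ![π, πℓ₂, πρ]`, HYPOTHESIS-FREE.  THE MEMBERS `zR = ![1, ℓ₂, ℓ_T]`, `zRpi = ![π, πℓ₂, πℓ_T]`: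
  (i) `linearIndependent_zR/zRpi`, (ii) `linLiouville_zR/zRpi` (= 33364's `∀ ω` binder), (iii)
  `not_hyperLinLiouville_zR/zRpi` (= its `¬ ∀ m` binder) — ALL HYPOTHESIS-FREE (`zR_in_scope_33364`,
  `zRpi_in_scope_33364`); (iv) `sb_zR (hNW) : SB 3 zR` (mod the named fact only) and `sb_zRpi : SB 3 zRpi` (NO
  hypothesis); `finiteOrderLiouvilleSchanuel_at_zR (hNW)` / `_at_zRpi` (4 conjuncts).

## The named fact
`NWMeasure` (tree, `RootDecomp1KHyper01`) is the VERBATIM text of the Literature decl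
`Literature.NumberTheory.Transcendental.NesterenkoWaldschmidt1996_thm_4_2` (Nesterenko–Waldschmidt 1996 Thm 4(2),
measure of `e`), which the tree PROVES (`Literature.NumberTheory.Transcendental.NesterenkoWaldschmidt1996_thm_4_2_holds`,
`ExpOneTranscendenceMeasureProofs.lean`); that module's cone (`…ExpOneTranscendenceMeasureParams`) is NOT built on
the check farm (rc 75 `remote:stale:unbuilt`, 2026-08-31T04:5xZ and 05:0xZ), so — exactly as the tree's Hyper01
docstring prescribes — the e-versions carry `(hNW : NWMeasure)`, dischargeable by name.  The π-versions need nothing.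

## The ladder (the lens; texts)
Item 33364's scope graded by the DIOPHANTINE TYPE OF THE NON-LIOUVILLE DATUM rather than by exponential order:
grade «moment curve of a real of exponential order k» — lens 6 g13/14, lens 1 g32/33; grade «prefix (1, ℓ₂) +
a LOG-HYPER-Liouville real» — THIS NODE (members `ℓ_T`, and every `ρ` with `|ρ − p/q| < exp(−(log q)^m)` ∀m);
grade «prefix (1, ℓ₂) + a LOG-SQUARE-but-not-log-hyper real» — the induced measure is silent (it loses one
logarithm per degree: exponent `d + 2`); grade «(ℓ₂, ℓ₂²)» / «(1, ℓ₂, ℓ₃)» — OPEN (needs a measure of `e^{p/q}`-type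
sums, Generic21 `liouvilleNumber_sq_open_cell_status`) = the wall.  Ceiling of the method family = the exponent
`d + 2` of the induced measure; recorded, not attacked.

Port target (census lane, if cleared): `Summits/Schanuel/Schanuel/Theorems/RootDecomp1KRelLiouvilleCell01…03.lean`
(§1–§3 · §4–§5 · §6–§8), `--supports stmt-Schanuel-33364`.
-/

noncomputable section

open Complex IntermediateField Polynomial
open Summit.Schanuel.Schanuel.Theorems.RootDecomp1KHyper
open Summit.Schanuel.Schanuel.Theorems.RootDecomp1KHyper.HyperCell
open Summit.Schanuel.Schanuel.Theorems.RootDecomp1KGeneric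

namespace Summit.Schanuel.Schanuel.Theorems.RootDecomp1KRelLiouvilleCell

/-! ## §1  Two approximation / measure classes at LOG-POWER scale -/

/-- **Log-power measure of algebraic independence** of a tuple `θ`: in every total degree `d` there are
`C > 0`, `k` with `|P(θ)| ≥ exp(−C·(1 + log len P)^k)` for all non-zero `P ∈ ℤ[X₁,…,Xₙ]` of total degree `≤ d`.
Strictly between `MvPolyMeasure` (`k = 1`) and `MvWeakMeasure` (`exp(−C·len^k)`). -/
def LogPowMeasure {n : ℕ} (θ : Fin n → ℂ) : Prop :=
  ∀ d : ℕ, ∃ (C : ℝ) (k : ℕ), 0 < C ∧ ∀ P : MvPolynomial (Fin n) ℤ, P ≠ 0 → P.totalDegree ≤ d →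
    Real.exp (-(C * (1 + Real.log ((mvlen P : ℤ) : ℝ)) ^ k)) ≤ ‖MvPolynomial.aeval θ P‖

/-- **Log-hyper-Liouville reals**: rational approximations beating EVERY LOG-POWER of the denominator,
`|ρ − p/q| < exp(−(log q)^m)` with `q ≥ m`, for every `m`.  Strictly between `LogSqLiouville`
(`exp(−m (log q)²)`) and exponential order 1 (`exp(−q)`); in particular such a `ρ` need not be
hyper-Liouville (for the explicit member `ℓ_T` of §6 what is PROVED is `LogHyperLiouville ℓ_T`, §6, and the
absence of hyper-small forms in `(1, ℓ₂, ℓ_T)`, §7–§8). -/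
def LogHyperLiouville (ρ : ℝ) : Prop :=
  ∀ m : ℕ, ∃ r : ℚ, m ≤ r.den ∧ ρ ≠ r ∧ |ρ - r| < Real.exp (-(Real.log r.den) ^ m)

/-- A tuple with a log-power measure annihilates no nonzero integer polynomial. -/
theorem mvaeval_ne_zero_of_logPowMeasure {n : ℕ} {θ : Fin n → ℂ} (hθ : LogPowMeasure θ)
    {P : MvPolynomial (Fin n) ℤ} (hP : P ≠ 0) : MvPolynomial.aeval θ P ≠ 0 := by
  intro h0
  obtain ⟨C, k, _, h⟩ := hθ P.totalDegree
  have h1 := h P hP le_rfl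
  rw [h0, norm_zero] at h1
  exact absurd h1 (not_le.mpr (Real.exp_pos _))

/-- `MvPolyMeasure ⇒ LogPowMeasure` (with `k = 1`: `1/(C L^τ) ≥ exp(−(C+τ)(1 + log L))`). -/
theorem MvPolyMeasure.logPowMeasure {n : ℕ} {θ : Fin n → ℂ} (hθ : MvPolyMeasure θ) :
    LogPowMeasure θ := by
  intro d
  obtain ⟨C, τ, hC, h⟩ := hθ d
  refine ⟨C + τ + 1, 1, by positivity, fun P hP hdeg => ?_⟩
  have h1 := h P hP hdeg
  set L : ℝ := ((mvlen P : ℤ) : ℝ) with hL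
  have hL1 : (1 : ℝ) ≤ L := by rw [hL]; exact_mod_cast one_le_mvlen hP
  have hlog0 : 0 ≤ Real.log L := Real.log_nonneg hL1
  have hy : 0 < C * L ^ τ := by positivity
  have h2 : (C * L ^ τ)⁻¹ ≤ ‖MvPolynomial.aeval θ P‖ := by
    rw [inv_le_iff_one_le_mul₀ hy]; linarith [h1]
  -- exp(−(C+τ+1)(1+log L)) ≤ exp(−(log C + τ log L)) = (C L^τ)⁻¹
  have hClog : Real.log C ≤ C := (Real.log_le_sub_one_of_pos hC).trans (by linarith)
  have e1 : (C * L ^ τ)⁻¹ = Real.exp (-Real.log (C * L ^ τ)) := by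
    rw [Real.exp_neg, Real.exp_log hy]
  have e2 : Real.log (C * L ^ τ) = Real.log C + τ * Real.log L := by
    rw [Real.log_mul hC.ne' (by positivity), Real.log_pow]
  have hexp : Real.exp (-((C + τ + 1) * (1 + Real.log L) ^ 1)) ≤ (C * L ^ τ)⁻¹ := by
    rw [e1, e2, pow_one]
    exact Real.exp_le_exp.mpr (by nlinarith [hClog, hlog0, hC])
  exact hexp.trans h2

/-- `LogPowMeasure ⇒ MvWeakMeasure` (`(1 + log L)^k ≤ (2L)^k`). -/
theorem LogPowMeasure.mvWeakMeasure {n : ℕ} {θ : Fin n → ℂ} (hθ : LogPowMeasure θ) :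
    MvWeakMeasure θ := by
  intro d
  obtain ⟨C, k, hC, h⟩ := hθ d
  refine ⟨C * 2 ^ k, k, by positivity, fun P hP hdeg => ?_⟩
  have h1 := h P hP hdeg
  set L : ℝ := ((mvlen P : ℤ) : ℝ) with hL
  have hL1 : (1 : ℝ) ≤ L := by rw [hL]; exact_mod_cast one_le_mvlen hP
  have hlogL : Real.log L ≤ L := (Real.log_le_sub_one_of_pos (by linarith)).trans (by linarith)
  have hb : (1 + Real.log L) ^ k ≤ (2 * L) ^ k :=
    pow_le_pow_left₀ (by linarith [Real.log_nonneg hL1]) (by linarith) k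
  refine le_trans (Real.exp_le_exp.mpr (neg_le_neg ?_)) h1
  calc C * (1 + Real.log L) ^ k ≤ C * (2 * L) ^ k := mul_le_mul_of_nonneg_left hb hC.le
    _ = C * 2 ^ k * L ^ k := by rw [mul_pow]; ring

/-- Hence a tuple with a `LogPowMeasure` is algebraically independent over `ℚ`. -/
theorem algebraicIndependent_of_logPowMeasure {n : ℕ} {θ : Fin n → ℂ} (hθ : LogPowMeasure θ) :
    AlgebraicIndependent ℚ θ :=
  algebraicIndependent_of_mvWeakMeasure hθ.mvWeakMeasure

/-- `HyperLiouville ⇒ LogHyperLiouville` (`(log q)^m ≤ q^m`). -/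
theorem HyperLiouville.logHyperLiouville {ρ : ℝ} (hρ : HyperLiouville ρ) : LogHyperLiouville ρ := by
  intro m
  obtain ⟨r, hden, hne, hlt⟩ := hρ (m + 1)
  refine ⟨r, by omega, hne, hlt.trans_le (Real.exp_le_exp.mpr (neg_le_neg ?_))⟩
  have hq1 : (1 : ℝ) ≤ r.den := by exact_mod_cast r.pos
  have hlog0 : 0 ≤ Real.log r.den := Real.log_nonneg hq1
  have hlogq : Real.log r.den ≤ r.den :=
    (Real.log_le_sub_one_of_pos (by linarith)).trans (by linarith)
  calc Real.log (r.den : ℝ) ^ m ≤ (r.den : ℝ) ^ m := pow_le_pow_left₀ hlog0 hlogq m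
    _ ≤ (r.den : ℝ) ^ (m + 1) := pow_le_pow_right₀ hq1 (by omega)

/-- `LogHyperLiouville ⇒ LogSqLiouville` (`m (log q)² ≤ (log q)³` once `log q ≥ m`). -/
theorem LogHyperLiouville.logSqLiouville {ρ : ℝ} (hρ : LogHyperLiouville ρ) : LogSqLiouville ρ := by
  intro m
  -- take the exponent `3` and a denominator `≥ 3^m ≥ m` so that `log q ≥ m log 3 ≥ m`
  obtain ⟨r, hden, hne, hlt⟩ := hρ (3 ^ (m + 1) + 3)
  have hq3 : (3 : ℝ) ^ (m + 1) ≤ r.den := by exact_mod_cast (show 3 ^ (m + 1) ≤ r.den by omega)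
  have hqpos : (0 : ℝ) < r.den := by exact_mod_cast r.pos
  have hm3 : m ≤ 3 ^ (m + 1) :=
    (Nat.lt_pow_self (by norm_num : 1 < 3)).le.trans (Nat.pow_le_pow_right (by norm_num) (by omega))
  refine ⟨r, by omega, hne, hlt.trans_le (Real.exp_le_exp.mpr (neg_le_neg ?_))⟩
  -- `m ≤ log q`: `log q ≥ (m+1) log 3 ≥ m + 1`
  have hlog3 : (1 : ℝ) ≤ Real.log 3 := by
    rw [← Real.log_exp 1]
    exact Real.log_le_log (Real.exp_pos 1) (by
      have := Real.exp_one_lt_d9; norm_num at this; linarith)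
  have hlogq : (m : ℝ) + 1 ≤ Real.log r.den := by
    have h1 : Real.log ((3 : ℝ) ^ (m + 1)) ≤ Real.log r.den :=
      Real.log_le_log (by positivity) hq3
    rw [Real.log_pow] at h1
    push_cast at h1
    nlinarith
  have hlog0 : 0 ≤ Real.log r.den := by linarith
  have hbig : 3 ^ (m + 1) + 3 ≥ 3 := by omega
  calc (m : ℝ) * Real.log r.den ^ 2 ≤ Real.log r.den * Real.log r.den ^ 2 := by
        apply mul_le_mul_of_nonneg_right (by linarith) (by positivity)
    _ = Real.log r.den ^ 3 := by ring
    _ ≤ Real.log r.den ^ (3 ^ (m + 1) + 3) := by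
        apply pow_le_pow_right₀ (by linarith) (by omega)

/-- `LogHyperLiouville ⇒ Liouville`. -/
theorem LogHyperLiouville.liouville {ρ : ℝ} (hρ : LogHyperLiouville ρ) : Liouville ρ :=
  hρ.logSqLiouville.liouville

/-! ## §2  Several-variables bookkeeping: a size bound, and splitting off the first variable -/

/-- `‖P(θ)‖ ≤ mvlen(P) · B^D` on the polydisc `‖θ_i‖ ≤ B` (`B ≥ 1`), for `totalDegree P ≤ D`. -/
theorem norm_mvaeval_le_mvlen_mul_pow {n : ℕ} (P : MvPolynomial (Fin n) ℤ) (θ : Fin n → ℂ) {B : ℝ}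
    (hB : 1 ≤ B) (hθ : ∀ i, ‖θ i‖ ≤ B) {D : ℕ} (hD : P.totalDegree ≤ D) :
    ‖MvPolynomial.aeval θ P‖ ≤ ((mvlen P : ℤ) : ℝ) * B ^ D := by
  classical
  rw [MvPolynomial.aeval_def, MvPolynomial.eval₂_eq']
  unfold mvlen
  push_cast
  rw [Finset.sum_mul]
  refine (norm_sum_le _ _).trans (Finset.sum_le_sum fun s hs => ?_)
  rw [norm_mul, algebraMap_int_eq, eq_intCast, Complex.norm_intCast]
  refine mul_le_mul_of_nonneg_left ?_ (abs_nonneg _)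
  have hdeg : (s.sum fun _ e => e) ≤ D := (MvPolynomial.le_totalDegree hs).trans hD
  calc ‖∏ i, θ i ^ s i‖ = ∏ i, ‖θ i‖ ^ s i := by rw [norm_prod]; simp [norm_pow]
    _ ≤ ∏ i, B ^ s i := by
        refine Finset.prod_le_prod (fun i _ => by positivity) fun i _ => ?_
        exact pow_le_pow_left₀ (norm_nonneg _) (hθ i) _
    _ = B ^ (∑ i, s i) := by rw [Finset.prod_pow_eq_pow_sum]
    _ ≤ B ^ D := by
        refine pow_le_pow_right₀ hB ?_
        have : (∑ i, s i) = s.sum fun _ e => e := by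
          rw [Finsupp.sum_fintype]; intro i; rfl
        rw [this]; exact hdeg

/-- The coefficients of `P ∈ ℤ[X₀,…,Xₙ]` as a polynomial in `X₀`: `G_k ∈ ℤ[X₁,…,Xₙ]`. -/
def ycoeff {n : ℕ} (P : MvPolynomial (Fin (n + 1)) ℤ) (k : ℕ) : MvPolynomial (Fin n) ℤ :=
  (MvPolynomial.finSuccEquiv ℤ n P).coeff k

/-- Evaluation at `Fin.cons y θ` = evaluation of `Σ_k G_k(θ) y^k`. -/
theorem mvaeval_cons_eq_sum {n : ℕ} (P : MvPolynomial (Fin (n + 1)) ℤ) (θ : Fin n → ℂ) (y : ℂ)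
    {K : ℕ} (hK : (MvPolynomial.finSuccEquiv ℤ n P).natDegree ≤ K) :
    MvPolynomial.aeval (Fin.cons y θ : Fin (n + 1) → ℂ) P =
      ∑ k ∈ Finset.range (K + 1), MvPolynomial.aeval θ (ycoeff P k) * y ^ k := by
  -- both sides are ring maps of `P`; compare them on the variables
  have key : ∀ Q : MvPolynomial (Fin (n + 1)) ℤ,
      MvPolynomial.aeval (Fin.cons y θ : Fin (n + 1) → ℂ) Q =
        Polynomial.eval₂ ((MvPolynomial.aeval θ : MvPolynomial (Fin n) ℤ →ₐ[ℤ] ℂ) :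
            MvPolynomial (Fin n) ℤ →+* ℂ) y (MvPolynomial.finSuccEquiv ℤ n Q) := by
    intro Q
    set φ : MvPolynomial (Fin (n + 1)) ℤ →+* ℂ :=
      ((MvPolynomial.aeval (Fin.cons y θ : Fin (n + 1) → ℂ) :
        MvPolynomial (Fin (n + 1)) ℤ →ₐ[ℤ] ℂ) : MvPolynomial (Fin (n + 1)) ℤ →+* ℂ) with hφ
    set ψ : MvPolynomial (Fin (n + 1)) ℤ →+* ℂ :=
      (Polynomial.eval₂RingHom ((MvPolynomial.aeval θ : MvPolynomial (Fin n) ℤ →ₐ[ℤ] ℂ) :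
          MvPolynomial (Fin n) ℤ →+* ℂ) y).comp
        ((MvPolynomial.finSuccEquiv ℤ n : MvPolynomial (Fin (n + 1)) ℤ ≃ₐ[ℤ]
            Polynomial (MvPolynomial (Fin n) ℤ)) :
          MvPolynomial (Fin (n + 1)) ℤ →+* Polynomial (MvPolynomial (Fin n) ℤ)) with hψ
    have hφψ : φ = ψ := by
      refine MvPolynomial.ringHom_ext' (RingHom.ext_int _ _) fun i => ?_
      refine Fin.cases ?_ (fun j => ?_) i
      · simp [φ, ψ, MvPolynomial.finSuccEquiv_X_zero]
      · simp [φ, ψ, MvPolynomial.finSuccEquiv_X_succ]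
    have h1 := RingHom.congr_fun hφψ Q
    simpa [φ, ψ] using h1
  rw [key, Polynomial.eval₂_eq_sum_range' _ (Nat.lt_succ_of_le hK)]
  simp only [ycoeff, RingHom.coe_coe]

/-- Lengths: `mvlen (G_k) ≤ mvlen P`. -/
theorem mvlen_ycoeff_le {n : ℕ} (P : MvPolynomial (Fin (n + 1)) ℤ) (k : ℕ) :
    mvlen (ycoeff P k) ≤ mvlen P := by
  classical
  unfold mvlen ycoeff
  set f : (Fin n →₀ ℕ) → (Fin (n + 1) →₀ ℕ) := fun m => m.cons k with hf
  have hinj : Function.Injective f := fun a b hab => by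
    have := congrArg Finsupp.tail hab
    simpa [hf] using this
  calc ∑ m ∈ ((MvPolynomial.finSuccEquiv ℤ n P).coeff k).support,
        |((MvPolynomial.finSuccEquiv ℤ n P).coeff k).coeff m|
      = ∑ m ∈ ((MvPolynomial.finSuccEquiv ℤ n P).coeff k).support, |P.coeff (f m)| := by
        refine Finset.sum_congr rfl fun m _ => ?_
        rw [MvPolynomial.finSuccEquiv_coeff_coeff]
    _ = ∑ m' ∈ (((MvPolynomial.finSuccEquiv ℤ n P).coeff k).support).image f, |P.coeff m'| := by
        rw [Finset.sum_image fun a _ b _ hab => hinj hab]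
    _ ≤ ∑ m' ∈ P.support, |P.coeff m'| := by
        refine Finset.sum_le_sum_of_subset_of_nonneg ?_ fun _ _ _ => abs_nonneg _
        intro m' hm'
        obtain ⟨m, hm, rfl⟩ := Finset.mem_image.mp hm'
        exact MvPolynomial.mem_support_coeff_finSuccEquiv.mp hm

/-- Degrees: `totalDegree (G_k) ≤ totalDegree P`. -/
theorem totalDegree_ycoeff_le {n : ℕ} (P : MvPolynomial (Fin (n + 1)) ℤ) (k : ℕ) :
    (ycoeff P k).totalDegree ≤ P.totalDegree := by
  by_cases h : ycoeff P k = 0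
  · rw [h, MvPolynomial.totalDegree_zero]; exact Nat.zero_le _
  · exact le_trans (Nat.le_add_right _ _) (MvPolynomial.totalDegree_coeff_finSuccEquiv_add_le P k h)

/-- The `X₀`-degree is at most the total degree. -/
theorem natDegree_finSuccEquiv_le_totalDegree {n : ℕ} (P : MvPolynomial (Fin (n + 1)) ℤ) :
    (MvPolynomial.finSuccEquiv ℤ n P).natDegree ≤ P.totalDegree := by
  rw [MvPolynomial.natDegree_finSuccEquiv]
  exact MvPolynomial.degreeOf_le_totalDegree P 0

end Summit.Schanuel.Schanuel.Theorems.RootDecomp1KRelLiouvilleCell
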